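import Summits.Ventures.CertifiedManyBodySolver.Downfold.TperpSeam
import Summits.Ventures.CertifiedManyBodySolver.Downfold.BoxesWordsSandwichV110
import Summits.Ventures.CertifiedManyBodySolver.Downfold.BoxesWordsSandwich
import HarnessLib

/-!
# Hypothesis-free LAYERED-CRYSTAL energy words on the typed boxes that carry a `tperp/t` row
# (La-214 x = 1/8 v1.10 object M, Na-CCOC M36 object M): hubbard-box-p1's `TperpSeam` adapter applied to
# hubbard-box-p2's M-cell sandwich windows

Venture CertifiedManyBodySolver, cell `pub/hubbard-downfold` (stage S1 ↔ S2 seam), seat hubbard-downfold-mod-1; namespace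
`Summit.Ventures.CertifiedManyBodySolver.Downfold`. `Downfold/TperpSeam.lean` (hubbard-box-p1, p501348: the `OneBandBox`
adapter of `Literature/…/LayeredLatticeEnergyTransport` keyed on the `tperp/t` entry) turns an S2 `_word_Icc` window `[L, R]`
on a box's `(U/t, tp/t, n)` cell into the window `[L − 2·max(|eZ.lo|, |eZ.hi|), R]` for the fixed-filling translation-invariant
ground-state energy density of the layered one-band crystal on `ℤ³` — `holdsOn_verticalHubbardTTPrime_of_window` (simple
tetragonal stacking: one vertical bond of amplitude the member's `tperp/t`) and `holdsOn_layeredHubbardTTPrime_of_window`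
(EVERY interlayer pattern `w_b`, `(w_b)₀ ≠ 0`, whose amplitudes satisfy `Σ_b |tz_b| ≤ |tperp/t|` — the body-centred stacking of
La-214 / Na-CCOC is such a pattern). Only two typed boxes of record print a `tperp/t` row today: `boxLa214M_M15v110`
(`BoxesLa214V110Controls`, row `[0.025, 0.085]`) and `boxCCOCM_M36` (`BoxesCCOC`, row `[0.005, 0.008]`). This file supplies

* the WINDOW-PARAMETRIC forms on those two boxes (`box…_layeredEnergyWord` vertical, `box…_layeredEnergyWord_pattern` every
  pattern): any future S2 window on the cell plugs in with one line;
* the INSTANCES with no hypothesis left, the windows being hubbard-box-p2's free-fermion / polarized-sea sandwich words on the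
  object-M cells (`sw_la214Mv110_M15_word`, `sw_naccocM_M36_word`):
  `boxLa214M_M15v110_layered_word_sandwich` — `[−1.6068078874 − 2·(17/200), −0.3628345691]`, decimal `[−1.777, −0.362]`;
  `boxCCOCM_M36_layered_word_sandwich` — `[−1.6057583347 − 2·(1/125), −0.2996777356]`, decimal `[−1.622, −0.299]`;
  and the same windows for every admissible interlayer pattern (`…_layered_word_sandwich_pattern`).

HONEST FRAMING: energy words only (fixed-filling translation-invariant ground-state energy densities); the layered object is
the `t–t'` plane model plus interlayer hopping — the `t''` residual of the Wannier object is the separate `TppSeamFilling`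
allowance and is NOT included here (a `t–t'–t''–t_z` word needs the two seams composed on a common object, not done in this
file); the boxes are S1's screening-grade intervals typed verbatim; nothing here bears on order, pairing, `T_c` or a phase word,
and no number about any material is certified. Everything is PROVED; no definition, no `sorry`.
-/

noncomputable section

namespace Summit.Ventures.CertifiedManyBodySolver.Downfold

open NonemptyInterval Literature.MathematicalPhysics.QuantumLattice
  Literature.MathematicalPhysics.QuantumLattice.ThermodynamicLimit Literature.Probability.LatticeModels
  Summit.Ventures.CertifiedManyBodySolver.Certificates

/-! ### §1 La₂₋ₓSrₓCuO₄ x = 1/8, the v1.10 object-M cell `U/t ∈ [5.1, 13.7]`, `tperp/t ∈ [0.025, 0.085]` -/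

/-- The `tperp/t` magnitude of `boxLa214M_M15v110`: `max |1/40| |17/200| = 17/200`. [folklore] -/
theorem la214M_M15v19_tperp_abs :
    (max |la214M_M15v19_tperp.encl.fst| |la214M_M15v19_tperp.encl.snd| : ℚ) = 17/200 := by
  rw [la214M_M15v19_tperp, Entry.encl_ofEnds_fst, Entry.encl_ofEnds_snd, abs_of_nonneg (by norm_num),
    abs_of_nonneg (by norm_num)]
  norm_num

/-- **Layered-crystal word on `boxLa214M_M15v110` from ANY S2 window, simple tetragonal stacking.** An S2 window
`[L, R]` for the `t–t'` energy density at filling `n` on the cell `Set.Icc ![51/10, -17/100, 171/200] ![137/10, -3/100, 179/200]`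
gives `L − 2·(17/200) ≤ e_{p n}(vertical crystal) ≤ R` on the box. [folklore] -/
theorem boxLa214M_M15v110_layeredEnergyWord {L R : ℝ}
    (hE : ∀ θ ∈ Set.Icc (![51/10, -17/100, 171/200] : Fin 3 → ℝ) ![137/10, -3/100, 179/200],
      L ≤ energyDensityTT' 1 (θ 1) (θ 0) (θ 2) ∧ energyDensityTT' 1 (θ 1) (θ 0) (θ 2) ≤ R) :
    HoldsOn (fun p : OneBandCoord → ℝ =>
      L - 2 * (17/200 : ℝ) ≤
          (layeredHubbardTTPrime 1 (p .tpOverT) (p .UOverT) (fun _ : Fin 1 => (unitVec (0 : Fin 3) : Site 3))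
            fun _ => p .tperpOverT).tiGroundEnergyDensityAt 1 (p .filling) ∧
        (layeredHubbardTTPrime 1 (p .tpOverT) (p .UOverT) (fun _ : Fin 1 => (unitVec (0 : Fin 3) : Site 3))
            fun _ => p .tperpOverT).tiGroundEnergyDensityAt 1 (p .filling) ≤ R) boxLa214M_M15v110 := by
  have h := holdsOn_verticalHubbardTTPrime_of_window (B := boxLa214M_M15v110) (eU := la214M_v110_U)
    (eS := la214M_M15v19_tp) (eN := la214M_M15v19_n) (eZ := la214M_M15v19_tperp) boxLa214M_M15v110_U
    boxLa214M_M15v110_tp boxLa214M_M15v110_n boxLa214M_M15v110_tperp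
    (by rw [la214M_v110_U, Entry.encl_ofEnds_fst]; norm_num)
    (by rw [la214M_M15v19_n, Entry.encl_ofEnds_fst]; norm_num)
    (by rw [la214M_M15v19_n, Entry.encl_ofEnds_snd]; norm_num)
    (L := L) (R := R) (by rw [la214M_M15v110_s2Lo, la214M_M15v110_s2Hi]; exact hE)
  rw [la214M_M15v19_tperp_abs] at h
  have hc : (((17/200 : ℚ)) : ℝ) = (17/200 : ℝ) := by norm_num
  rw [hc] at h
  exact h

/-- **Layered-crystal word on `boxLa214M_M15v110` from ANY S2 window, EVERY interlayer pattern** (vectors `w_b` with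
`(w_b)₀ ≠ 0` in the range box `R' ≥ 1`; amplitudes with `Σ_b |tz_b| ≤ |p tperp/t|` — e.g. the body-centred stacking):
`L − 2·(17/200) ≤ e_{p n}(layered crystal) ≤ R` on the box. [folklore] -/
theorem boxLa214M_M15v110_layeredEnergyWord_pattern {L R : ℝ}
    (hE : ∀ θ ∈ Set.Icc (![51/10, -17/100, 171/200] : Fin 3 → ℝ) ![137/10, -3/100, 179/200],
      L ≤ energyDensityTT' 1 (θ 1) (θ 0) (θ 2) ∧ energyDensityTT' 1 (θ 1) (θ 0) (θ 2) ≤ R)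
    {κ : Type*} [Fintype κ] {w : κ → Site 3} (hw : ∀ b, w b 0 ≠ 0) {R' : ℝ} (hR' : 1 ≤ R')
    (hwR' : ∀ b, w b ∈ thicken ({0} : Finset (Site 3)) R') :
    HoldsOn (fun p : OneBandCoord → ℝ => ∀ tz : κ → ℝ, ∑ b, |tz b| ≤ |p .tperpOverT| →
      L - 2 * (17/200 : ℝ) ≤
          (layeredHubbardTTPrime 1 (p .tpOverT) (p .UOverT) w tz).tiGroundEnergyDensityAt R' (p .filling) ∧
        (layeredHubbardTTPrime 1 (p .tpOverT) (p .UOverT) w tz).tiGroundEnergyDensityAt R' (p .filling) ≤ R)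
      boxLa214M_M15v110 := by
  have h := holdsOn_layeredHubbardTTPrime_of_window (B := boxLa214M_M15v110) (eU := la214M_v110_U)
    (eS := la214M_M15v19_tp) (eN := la214M_M15v19_n) (eZ := la214M_M15v19_tperp) boxLa214M_M15v110_U
    boxLa214M_M15v110_tp boxLa214M_M15v110_n boxLa214M_M15v110_tperp
    (by rw [la214M_v110_U, Entry.encl_ofEnds_fst]; norm_num)
    (by rw [la214M_M15v19_n, Entry.encl_ofEnds_fst]; norm_num)
    (by rw [la214M_M15v19_n, Entry.encl_ofEnds_snd]; norm_num)
    (L := L) (R := R) (by rw [la214M_M15v110_s2Lo, la214M_M15v110_s2Hi]; exact hE) hw hR' hwR'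
  rw [la214M_M15v19_tperp_abs] at h
  have hc : (((17/200 : ℚ)) : ℝ) = (17/200 : ℝ) := by norm_num
  rw [hc] at h
  exact h

/-- **Hypothesis-free LAYERED word on `boxLa214M_M15v110`** (simple tetragonal stacking): the `t–t'–t_z` crystal at every member
has energy density in `[−1.6068078874 − 2·(17/200), −0.3628345691]` (hubbard-box-p2's `sw_la214Mv110_M15_word` through the seam).
[folklore] -/
theorem boxLa214M_M15v110_layered_word_sandwich :
    HoldsOn (fun p : OneBandCoord → ℝ =>
      (-1.6068078874 : ℝ) - 2 * (17/200 : ℝ) ≤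
          (layeredHubbardTTPrime 1 (p .tpOverT) (p .UOverT) (fun _ : Fin 1 => (unitVec (0 : Fin 3) : Site 3))
            fun _ => p .tperpOverT).tiGroundEnergyDensityAt 1 (p .filling) ∧
        (layeredHubbardTTPrime 1 (p .tpOverT) (p .UOverT) (fun _ : Fin 1 => (unitVec (0 : Fin 3) : Site 3))
            fun _ => p .tperpOverT).tiGroundEnergyDensityAt 1 (p .filling) ≤ (-0.3628345691 : ℝ))
      boxLa214M_M15v110 :=
  boxLa214M_M15v110_layeredEnergyWord sw_la214Mv110_M15_word

/-- **Decimal enclosure of the layered word on `boxLa214M_M15v110`**: `−1.777 ≤ e_{p n}(vertical crystal) ≤ −0.362`. [folklore] -/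
theorem boxLa214M_M15v110_layered_word_sandwich_decimal :
    HoldsOn (fun p : OneBandCoord → ℝ =>
      (-1.777 : ℝ) ≤
          (layeredHubbardTTPrime 1 (p .tpOverT) (p .UOverT) (fun _ : Fin 1 => (unitVec (0 : Fin 3) : Site 3))
            fun _ => p .tperpOverT).tiGroundEnergyDensityAt 1 (p .filling) ∧
        (layeredHubbardTTPrime 1 (p .tpOverT) (p .UOverT) (fun _ : Fin 1 => (unitVec (0 : Fin 3) : Site 3))
            fun _ => p .tperpOverT).tiGroundEnergyDensityAt 1 (p .filling) ≤ (-0.362 : ℝ)) boxLa214M_M15v110 := by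
  refine boxLa214M_M15v110_layered_word_sandwich.mono fun p hp => ?_
  constructor
  · linarith [hp.1]
  · linarith [hp.2]

/-- **Hypothesis-free LAYERED word on `boxLa214M_M15v110`, EVERY interlayer pattern**: for vectors `w_b` (`(w_b)₀ ≠ 0`, in the
range box `R' ≥ 1`) and amplitudes with `Σ_b |tz_b| ≤ |p tperp/t|`, the layered crystal's energy density lies in
`[−1.6068078874 − 2·(17/200), −0.3628345691]`. [folklore] -/
theorem boxLa214M_M15v110_layered_word_sandwich_pattern {κ : Type*} [Fintype κ] {w : κ → Site 3}
    (hw : ∀ b, w b 0 ≠ 0) {R' : ℝ} (hR' : 1 ≤ R') (hwR' : ∀ b, w b ∈ thicken ({0} : Finset (Site 3)) R') :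
    HoldsOn (fun p : OneBandCoord → ℝ => ∀ tz : κ → ℝ, ∑ b, |tz b| ≤ |p .tperpOverT| →
      (-1.6068078874 : ℝ) - 2 * (17/200 : ℝ) ≤
          (layeredHubbardTTPrime 1 (p .tpOverT) (p .UOverT) w tz).tiGroundEnergyDensityAt R' (p .filling) ∧
        (layeredHubbardTTPrime 1 (p .tpOverT) (p .UOverT) w tz).tiGroundEnergyDensityAt R' (p .filling) ≤
          (-0.3628345691 : ℝ)) boxLa214M_M15v110 :=
  boxLa214M_M15v110_layeredEnergyWord_pattern sw_la214Mv110_M15_word hw hR' hwR'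

/-! ### §2 Ca₂₋ₓNaₓCuO₂Cl₂ x = 0.10, the object-M cell of box #36, `tperp/t ∈ [0.005, 0.008]` -/

/-- The `tperp/t` magnitude of `boxCCOCM_M36`: `max |1/200| |1/125| = 1/125`. [folklore] -/
theorem cCOCM_M36_tperp_abs : (max |cCOCM_M36_tperp.encl.fst| |cCOCM_M36_tperp.encl.snd| : ℚ) = 1/125 := by
  rw [cCOCM_M36_tperp, Entry.encl_ofEnds_fst, Entry.encl_ofEnds_snd, abs_of_nonneg (by norm_num),
    abs_of_nonneg (by norm_num)]
  norm_num

/-- **Layered-crystal word on `boxCCOCM_M36` from ANY S2 window, simple tetragonal stacking.** An S2 window `[L, R]` on the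
cell `Set.Icc ![157/25, -237/1000, 22/25] ![59/5, -19/250, 23/25]` gives `L − 2·(1/125) ≤ e_{p n}(vertical crystal) ≤ R` on the
box. [folklore] -/
theorem boxCCOCM_M36_layeredEnergyWord {L R : ℝ}
    (hE : ∀ θ ∈ Set.Icc (![157/25, -237/1000, 22/25] : Fin 3 → ℝ) ![59/5, -19/250, 23/25],
      L ≤ energyDensityTT' 1 (θ 1) (θ 0) (θ 2) ∧ energyDensityTT' 1 (θ 1) (θ 0) (θ 2) ≤ R) :
    HoldsOn (fun p : OneBandCoord → ℝ =>
      L - 2 * (1/125 : ℝ) ≤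
          (layeredHubbardTTPrime 1 (p .tpOverT) (p .UOverT) (fun _ : Fin 1 => (unitVec (0 : Fin 3) : Site 3))
            fun _ => p .tperpOverT).tiGroundEnergyDensityAt 1 (p .filling) ∧
        (layeredHubbardTTPrime 1 (p .tpOverT) (p .UOverT) (fun _ : Fin 1 => (unitVec (0 : Fin 3) : Site 3))
            fun _ => p .tperpOverT).tiGroundEnergyDensityAt 1 (p .filling) ≤ R) boxCCOCM_M36 := by
  have h := holdsOn_verticalHubbardTTPrime_of_window (B := boxCCOCM_M36) (eU := cCOCM_M36_U) (eS := cCOCM_M36_tp)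
    (eN := cCOCM_M36_n) (eZ := cCOCM_M36_tperp) rfl rfl rfl rfl
    (by rw [cCOCM_M36_U, Entry.encl_ofEnds_fst]; norm_num)
    (by rw [cCOCM_M36_n, Entry.encl_ofEnds_fst]; norm_num)
    (by rw [cCOCM_M36_n, Entry.encl_ofEnds_snd]; norm_num)
    (L := L) (R := R) (by rw [cCOCM_M36_s2Lo, cCOCM_M36_s2Hi]; exact hE)
  rw [cCOCM_M36_tperp_abs] at h
  have hc : (((1/125 : ℚ)) : ℝ) = (1/125 : ℝ) := by norm_num
  rw [hc] at h
  exact h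

/-- **Layered-crystal word on `boxCCOCM_M36` from ANY S2 window, EVERY interlayer pattern** (`(w_b)₀ ≠ 0`, range box
`R' ≥ 1`, `Σ_b |tz_b| ≤ |p tperp/t|`): `L − 2·(1/125) ≤ e_{p n}(layered crystal) ≤ R` on the box. [folklore] -/
theorem boxCCOCM_M36_layeredEnergyWord_pattern {L R : ℝ}
    (hE : ∀ θ ∈ Set.Icc (![157/25, -237/1000, 22/25] : Fin 3 → ℝ) ![59/5, -19/250, 23/25],
      L ≤ energyDensityTT' 1 (θ 1) (θ 0) (θ 2) ∧ energyDensityTT' 1 (θ 1) (θ 0) (θ 2) ≤ R)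
    {κ : Type*} [Fintype κ] {w : κ → Site 3} (hw : ∀ b, w b 0 ≠ 0) {R' : ℝ} (hR' : 1 ≤ R')
    (hwR' : ∀ b, w b ∈ thicken ({0} : Finset (Site 3)) R') :
    HoldsOn (fun p : OneBandCoord → ℝ => ∀ tz : κ → ℝ, ∑ b, |tz b| ≤ |p .tperpOverT| →
      L - 2 * (1/125 : ℝ) ≤
          (layeredHubbardTTPrime 1 (p .tpOverT) (p .UOverT) w tz).tiGroundEnergyDensityAt R' (p .filling) ∧
        (layeredHubbardTTPrime 1 (p .tpOverT) (p .UOverT) w tz).tiGroundEnergyDensityAt R' (p .filling) ≤ R)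
      boxCCOCM_M36 := by
  have h := holdsOn_layeredHubbardTTPrime_of_window (B := boxCCOCM_M36) (eU := cCOCM_M36_U) (eS := cCOCM_M36_tp)
    (eN := cCOCM_M36_n) (eZ := cCOCM_M36_tperp) rfl rfl rfl rfl
    (by rw [cCOCM_M36_U, Entry.encl_ofEnds_fst]; norm_num)
    (by rw [cCOCM_M36_n, Entry.encl_ofEnds_fst]; norm_num)
    (by rw [cCOCM_M36_n, Entry.encl_ofEnds_snd]; norm_num)
    (L := L) (R := R) (by rw [cCOCM_M36_s2Lo, cCOCM_M36_s2Hi]; exact hE) hw hR' hwR'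
  rw [cCOCM_M36_tperp_abs] at h
  have hc : (((1/125 : ℚ)) : ℝ) = (1/125 : ℝ) := by norm_num
  rw [hc] at h
  exact h

/-- **Hypothesis-free LAYERED word on `boxCCOCM_M36`** (simple tetragonal stacking): energy density of the `t–t'–t_z` crystal in
`[−1.6057583347 − 2·(1/125), −0.2996777356]` (`sw_naccocM_M36_word` through the seam). [folklore] -/
theorem boxCCOCM_M36_layered_word_sandwich :
    HoldsOn (fun p : OneBandCoord → ℝ =>
      (-1.6057583347 : ℝ) - 2 * (1/125 : ℝ) ≤
          (layeredHubbardTTPrime 1 (p .tpOverT) (p .UOverT) (fun _ : Fin 1 => (unitVec (0 : Fin 3) : Site 3))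
            fun _ => p .tperpOverT).tiGroundEnergyDensityAt 1 (p .filling) ∧
        (layeredHubbardTTPrime 1 (p .tpOverT) (p .UOverT) (fun _ : Fin 1 => (unitVec (0 : Fin 3) : Site 3))
            fun _ => p .tperpOverT).tiGroundEnergyDensityAt 1 (p .filling) ≤ (-0.2996777356 : ℝ)) boxCCOCM_M36 :=
  boxCCOCM_M36_layeredEnergyWord sw_naccocM_M36_word

/-- **Decimal enclosure of the layered word on `boxCCOCM_M36`**: `−1.622 ≤ e_{p n}(vertical crystal) ≤ −0.299`. [folklore] -/
theorem boxCCOCM_M36_layered_word_sandwich_decimal :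
    HoldsOn (fun p : OneBandCoord → ℝ =>
      (-1.622 : ℝ) ≤
          (layeredHubbardTTPrime 1 (p .tpOverT) (p .UOverT) (fun _ : Fin 1 => (unitVec (0 : Fin 3) : Site 3))
            fun _ => p .tperpOverT).tiGroundEnergyDensityAt 1 (p .filling) ∧
        (layeredHubbardTTPrime 1 (p .tpOverT) (p .UOverT) (fun _ : Fin 1 => (unitVec (0 : Fin 3) : Site 3))
            fun _ => p .tperpOverT).tiGroundEnergyDensityAt 1 (p .filling) ≤ (-0.299 : ℝ)) boxCCOCM_M36 := by
  refine boxCCOCM_M36_layered_word_sandwich.mono fun p hp => ?_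
  constructor
  · linarith [hp.1]
  · linarith [hp.2]

/-- **Hypothesis-free LAYERED word on `boxCCOCM_M36`, EVERY interlayer pattern**: for vectors `w_b` (`(w_b)₀ ≠ 0`, range box
`R' ≥ 1`) and amplitudes with `Σ_b |tz_b| ≤ |p tperp/t|`, the layered crystal's energy density lies in
`[−1.6057583347 − 2·(1/125), −0.2996777356]`. [folklore] -/
theorem boxCCOCM_M36_layered_word_sandwich_pattern {κ : Type*} [Fintype κ] {w : κ → Site 3} (hw : ∀ b, w b 0 ≠ 0)
    {R' : ℝ} (hR' : 1 ≤ R') (hwR' : ∀ b, w b ∈ thicken ({0} : Finset (Site 3)) R') :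
    HoldsOn (fun p : OneBandCoord → ℝ => ∀ tz : κ → ℝ, ∑ b, |tz b| ≤ |p .tperpOverT| →
      (-1.6057583347 : ℝ) - 2 * (1/125 : ℝ) ≤
          (layeredHubbardTTPrime 1 (p .tpOverT) (p .UOverT) w tz).tiGroundEnergyDensityAt R' (p .filling) ∧
        (layeredHubbardTTPrime 1 (p .tpOverT) (p .UOverT) w tz).tiGroundEnergyDensityAt R' (p .filling) ≤
          (-0.2996777356 : ℝ)) boxCCOCM_M36 :=
  boxCCOCM_M36_layeredEnergyWord_pattern sw_naccocM_M36_word hw hR' hwR'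

end Summit.Ventures.CertifiedManyBodySolver.Downfold

end
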